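import Summits.CriticalPhenomena.PercolationContinuityZ3.Theorems.PercNearOneGluingNoHeavyLowerTailSunflowerEdgeDecomposition
import HarnessLib

/-!
# `NoHeavyLowerTail` (crux stmt-CriticalPhenomena-4575), abstract sunflower cubic: THE EDGE CELL INEQUALITY `EdgeLemma` IS FALSE
# (an explicit three-petal counterexample; hence the `EdgeLemma` hypothesis of `safe_edgeCore_cycleGraph_of_inequalities` is
# unsatisfiable and the g68 edge decomposition does NOT yet give the cycles)

Support file (seat `prim-ineq-prove-1` gen 69; `--supports stmt-CriticalPhenomena-4575`).  No `sorry`, no named facts, no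
definitions.  Memo: run/shared/lean/prim/prim-ineq-prove-1/FINDING-GRADED-prove1-g69.md §6.

`EdgeLemma p r g₀ gL gR` (`…SunflowerEdgeDecomposition`, gen 68) relaxes the edge-conditioned petal sections `(X_k, Y_k, Z_k)`
to their three measures `(x_k, y_k, z_k)` with `z ≤ min(x, y)` and the sub-family budgets X, Y, Z, ZX, ZY, MX, MY.  The relaxation
is too coarse: **`edgeLemma_counterexample`** — for `p = 1/20`, `r = 1/50`, `g₀ = 1/1000`, `gL = 1/25`, `gR = 2/25` the three
petals `(x,y,z) = (1/25, 1, 1/1000)`, `(1, 2/25, 1/500)`, `(1/25, 2/25, 1/25)` satisfy EVERY hypothesis (all `2³` sub-families and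
all disjoint pairs; the budgets U, V, ZX, ZY are tight) while `∏ f_k = 637255979283/1.25·10¹⁶ > F² = 29278921/10¹²` (ratio ≈ 1.741).
The third petal is the culprit: its `z`-section equals its `x`-section (`z = x = gL`), which for genuine up-set sections forces the
`y`-section to contain `P_L ∪ P_R` — a constraint (`y ≥ μ(Z ∪ P_R)`) that the measure relaxation does not record.
**`not_forall_edgeLemma`**: consequently the hypothesis `hE` of `safe_edgeCore_cycleGraph_of_inequalities` (`…SunflowerCycleSafe`)
and of `aSafe_edgeCore_close_leaves` (`…SunflowerCycleEdge`) cannot be met; those theorems are vacuous as stated and the cycle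
programme needs a finer cell inequality (memo §6).  (The other hypothesis, `GradedTBern`, IS a theorem: `gradedTBern_holds`.)
The two helper lemmas derive the sub-family and two-level budgets from whole-family "max" products (how the witness is checked).
-/

noncomputable section

namespace Summit.CriticalPhenomena.PercolationContinuityZ3.Theorems.SunflowerPartition

namespace SafeCalc

namespace LinkedCurrency

open Finset

/-- Sub-family budgets from the whole-family one: if `c ≤ f_k` for all `k` (`c > 0`) and `∏_univ f ≤ c^(n−1)`, then
`∏_S f ≤ c^(|S|−1)` for every `S`. [this work] -/
theorem prod_sub_le_of_prod_le {ι : Type*} [Fintype ι] [DecidableEq ι] {f : ι → ℝ} {c : ℝ} (hc : 0 < c)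
    (hf : ∀ k, c ≤ f k) (h : ∏ k, f k ≤ c ^ (Fintype.card ι - 1)) (S : Finset ι) : ∏ k ∈ S, f k ≤ c ^ (S.card - 1) := by
  rcases S.eq_empty_or_nonempty with hS | hS
  · rw [hS, prod_empty, card_empty]; simp
  have hsplit : (∏ k ∈ S, f k) * ∏ k ∈ Sᶜ, f k = ∏ k, f k := prod_mul_prod_compl S f
  have hrest : c ^ Sᶜ.card ≤ ∏ k ∈ Sᶜ, f k := by
    rw [← prod_const]; exact prod_le_prod (fun _ _ => hc.le) fun k _ => hf k
  have hcard : Fintype.card ι - 1 = (S.card - 1) + Sᶜ.card := by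
    rw [card_compl]; have := hS.card_pos; have := card_le_univ S; omega
  have hS0 : 0 ≤ ∏ k ∈ S, f k := prod_nonneg fun k _ => hc.le.trans (hf k)
  have h1 : (∏ k ∈ S, f k) * c ^ Sᶜ.card ≤ c ^ (S.card - 1) * c ^ Sᶜ.card := by
    calc (∏ k ∈ S, f k) * c ^ Sᶜ.card ≤ (∏ k ∈ S, f k) * ∏ k ∈ Sᶜ, f k := mul_le_mul_of_nonneg_left hrest hS0
      _ = ∏ k, f k := hsplit
      _ ≤ c ^ (Fintype.card ι - 1) := h
      _ = c ^ (S.card - 1) * c ^ Sᶜ.card := by rw [hcard, pow_add]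
  exact le_of_mul_le_mul_right h1 (pow_pos hc _)

/-- Two-level budgets from a whole-family "max" product: if `g₀ ≤ z_k`, `gL ≤ x_k` (`g₀, gL > 0`) and
`∏_univ max(z_k/g₀, x_k/gL) ≤ 1/g₀`, then `∏_S z · ∏_{S'} x ≤ g₀^(|S|−1)·gL^|S'|` for all disjoint `S, S'` with `S ≠ ∅`. [this work] -/
theorem twoLevel_of_max_prod {ι : Type*} [Fintype ι] [DecidableEq ι] {z x : ι → ℝ} {g₀ gL : ℝ} (hg₀ : 0 < g₀) (hgL : 0 < gL)
    (hz : ∀ k, g₀ ≤ z k) (hx : ∀ k, gL ≤ x k) (h : ∏ k, max (z k / g₀) (x k / gL) ≤ 1 / g₀) (S S' : Finset ι)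
    (hd : Disjoint S S') (hS : S.Nonempty) : (∏ k ∈ S, z k) * ∏ k ∈ S', x k ≤ g₀ ^ (S.card - 1) * gL ^ S'.card := by
  set mx : ι → ℝ := fun k => max (z k / g₀) (x k / gL) with hmx
  have hm1 : ∀ k, 1 ≤ mx k := fun k => le_max_of_le_left ((one_le_div hg₀).2 (hz k))
  have hzS : ∏ k ∈ S, z k = g₀ ^ S.card * ∏ k ∈ S, z k / g₀ := by
    rw [prod_div_distrib, prod_const, mul_div_cancel₀ _ (pow_ne_zero _ hg₀.ne')]
  have hxS : ∏ k ∈ S', x k = gL ^ S'.card * ∏ k ∈ S', x k / gL := by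
    rw [prod_div_distrib, prod_const, mul_div_cancel₀ _ (pow_ne_zero _ hgL.ne')]
  have h1 : ∏ k ∈ S, z k / g₀ ≤ ∏ k ∈ S, mx k :=
    prod_le_prod (fun k _ => div_nonneg (hg₀.le.trans (hz k)) hg₀.le) fun k _ => le_max_left _ _
  have h2 : ∏ k ∈ S', x k / gL ≤ ∏ k ∈ S', mx k :=
    prod_le_prod (fun k _ => div_nonneg (hgL.le.trans (hx k)) hgL.le) fun k _ => le_max_right _ _
  have h3 : (∏ k ∈ S, mx k) * ∏ k ∈ S', mx k ≤ 1 / g₀ := by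
    rw [← prod_union hd]
    refine le_trans ?_ h
    rw [← prod_mul_prod_compl (S ∪ S') mx]
    have hc1 : 1 ≤ ∏ k ∈ (S ∪ S')ᶜ, mx k := Pendant.one_le_prod_of_one_le _ fun k _ => hm1 k
    have h0 : 0 ≤ ∏ k ∈ S ∪ S', mx k := prod_nonneg fun k _ => zero_le_one.trans (hm1 k)
    nlinarith
  obtain ⟨m, hm⟩ : ∃ m, S.card = m + 1 := ⟨S.card - 1, by have := hS.card_pos; omega⟩
  have h0S : 0 ≤ ∏ k ∈ S, z k / g₀ := prod_nonneg fun k _ => div_nonneg (hg₀.le.trans (hz k)) hg₀.le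
  have h0S' : 0 ≤ ∏ k ∈ S', x k / gL := prod_nonneg fun k _ => div_nonneg (hgL.le.trans (hx k)) hgL.le
  have h4 : (∏ k ∈ S, z k / g₀) * ∏ k ∈ S', x k / gL ≤ 1 / g₀ :=
    (mul_le_mul h1 h2 h0S' ((h0S.trans h1))).trans h3
  rw [hzS, hxS]
  calc g₀ ^ S.card * (∏ k ∈ S, z k / g₀) * (gL ^ S'.card * ∏ k ∈ S', x k / gL)
      = (g₀ ^ S.card * gL ^ S'.card) * ((∏ k ∈ S, z k / g₀) * ∏ k ∈ S', x k / gL) := by ring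
    _ ≤ (g₀ ^ S.card * gL ^ S'.card) * (1 / g₀) := mul_le_mul_of_nonneg_left h4 (by positivity)
    _ = g₀ ^ (S.card - 1) * gL ^ S'.card := by
        rw [hm, Nat.add_sub_cancel, pow_succ]; field_simp

/-- **`EdgeLemma` IS FALSE**: the parameters `p = 1/20`, `r = 1/50`, `g₀ = 1/1000`, `gL = 1/25`, `gR = 2/25` and the petals
`(x,y,z) = (1/25, 1, 1/1000)`, `(1, 2/25, 1/500)`, `(1/25, 2/25, 1/25)` satisfy all hypotheses and violate the conclusion
(`∏f/F² ≈ 1.741`). [this work] -/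
theorem edgeLemma_counterexample : ¬ EdgeLemma (1 / 20) (1 / 50) (1 / 1000) (1 / 25) (2 / 25) := by
  intro h
  have hx : ∀ k : Fin 3, (1 / 25 : ℝ) ≤ ![1 / 25, 1, 1 / 25] k := by intro k; fin_cases k <;> norm_num
  have hx1 : ∀ k : Fin 3, ![(1 / 25 : ℝ), 1, 1 / 25] k ≤ 1 := by intro k; fin_cases k <;> norm_num
  have hy : ∀ k : Fin 3, (2 / 25 : ℝ) ≤ ![1, 2 / 25, 2 / 25] k := by intro k; fin_cases k <;> norm_num
  have hy1 : ∀ k : Fin 3, ![(1 : ℝ), 2 / 25, 2 / 25] k ≤ 1 := by intro k; fin_cases k <;> norm_num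
  have hz : ∀ k : Fin 3, (1 / 1000 : ℝ) ≤ ![1 / 1000, 1 / 500, 1 / 25] k := by intro k; fin_cases k <;> norm_num
  have hzx : ∀ k : Fin 3, ![(1 / 1000 : ℝ), 1 / 500, 1 / 25] k ≤ ![1 / 25, 1, 1 / 25] k := by
    intro k; fin_cases k <;> norm_num
  have hzy : ∀ k : Fin 3, ![(1 / 1000 : ℝ), 1 / 500, 1 / 25] k ≤ ![1, 2 / 25, 2 / 25] k := by
    intro k; fin_cases k <;> norm_num
  have hX : ∀ S : Finset (Fin 3), ∏ k ∈ S, ![(1 / 25 : ℝ), 1, 1 / 25] k ≤ (1 / 25 : ℝ) ^ (S.card - 1) :=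
    prod_sub_le_of_prod_le (by norm_num) hx (by rw [Fin.prod_univ_three]; simp; norm_num)
  have hY : ∀ S : Finset (Fin 3), ∏ k ∈ S, ![(1 : ℝ), 2 / 25, 2 / 25] k ≤ (2 / 25 : ℝ) ^ (S.card - 1) :=
    prod_sub_le_of_prod_le (by norm_num) hy (by rw [Fin.prod_univ_three]; simp; norm_num)
  have hZ : ∀ S : Finset (Fin 3), ∏ k ∈ S, ![(1 / 1000 : ℝ), 1 / 500, 1 / 25] k ≤ (1 / 1000 : ℝ) ^ (S.card - 1) :=
    prod_sub_le_of_prod_le (by norm_num) hz (by rw [Fin.prod_univ_three]; simp; norm_num)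
  have hZX : ∀ S S' : Finset (Fin 3), Disjoint S S' → S.Nonempty →
      (∏ k ∈ S, ![(1 / 1000 : ℝ), 1 / 500, 1 / 25] k) * ∏ k ∈ S', ![(1 / 25 : ℝ), 1, 1 / 25] k ≤
        (1 / 1000 : ℝ) ^ (S.card - 1) * (1 / 25 : ℝ) ^ S'.card :=
    twoLevel_of_max_prod (by norm_num) (by norm_num) hz hx (by rw [Fin.prod_univ_three]; simp; norm_num)
  have hZY : ∀ S S' : Finset (Fin 3), Disjoint S S' → S.Nonempty →
      (∏ k ∈ S, ![(1 / 1000 : ℝ), 1 / 500, 1 / 25] k) * ∏ k ∈ S', ![(1 : ℝ), 2 / 25, 2 / 25] k ≤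
        (1 / 1000 : ℝ) ^ (S.card - 1) * (2 / 25 : ℝ) ^ S'.card :=
    twoLevel_of_max_prod (by norm_num) (by norm_num) hz hy (by rw [Fin.prod_univ_three]; simp; norm_num)
  have hMX : ∀ S : Finset (Fin 3), ∏ k ∈ S, ((1 / 20 : ℝ) * ![(1 / 25 : ℝ), 1, 1 / 25] k +
      (1 - 1 / 20) * ![(1 / 1000 : ℝ), 1 / 500, 1 / 25] k) ≤ ((1 / 20 : ℝ) * (1 / 25) + (1 - 1 / 20) * (1 / 1000)) ^ (S.card - 1) := by
    refine prod_sub_le_of_prod_le (by norm_num) (fun k => ?_) (by rw [Fin.prod_univ_three]; simp; norm_num)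
    fin_cases k <;> norm_num
  have hMY : ∀ S : Finset (Fin 3), ∏ k ∈ S, ((1 / 50 : ℝ) * ![(1 : ℝ), 2 / 25, 2 / 25] k +
      (1 - 1 / 50) * ![(1 / 1000 : ℝ), 1 / 500, 1 / 25] k) ≤ ((1 / 50 : ℝ) * (2 / 25) + (1 - 1 / 50) * (1 / 1000)) ^ (S.card - 1) := by
    refine prod_sub_le_of_prod_le (by norm_num) (fun k => ?_) (by rw [Fin.prod_univ_three]; simp; norm_num)
    fin_cases k <;> norm_num
  have key := h 3 ![1 / 25, 1, 1 / 25] ![1, 2 / 25, 2 / 25] ![1 / 1000, 1 / 500, 1 / 25] hx hx1 hy hy1 hz hzx hzy hX hY hZ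
    hZX hZY hMX hMY
  rw [Fin.prod_univ_three] at key
  simp at key
  norm_num at key

/-- **The `EdgeLemma` hypothesis of the conditional cycle theorems is unsatisfiable**: it is not true that `EdgeLemma p r g₀ gL gR`
holds for all `0 ≤ p, r ≤ 1`, `0 < g₀ ≤ gL ≤ 1`, `g₀ ≤ gR ≤ 1` (so `safe_edgeCore_cycleGraph_of_inequalities` and
`aSafe_edgeCore_close_leaves` are vacuous as stated). [this work] -/
theorem not_forall_edgeLemma :
    ¬ ∀ p r g₀ gL gR : ℝ, 0 ≤ p → p ≤ 1 → 0 ≤ r → r ≤ 1 → 0 < g₀ → g₀ ≤ gL → gL ≤ 1 → g₀ ≤ gR → gR ≤ 1 →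
      EdgeLemma p r g₀ gL gR :=
  fun h => edgeLemma_counterexample (h _ _ _ _ _ (by norm_num) (by norm_num) (by norm_num) (by norm_num) (by norm_num)
    (by norm_num) (by norm_num) (by norm_num) (by norm_num))

end LinkedCurrency

end SafeCalc

end Summit.CriticalPhenomena.PercolationContinuityZ3.Theorems.SunflowerPartition
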